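import Literature.Probability.LatticeModels.SixVertexCylinderLimit

/-!
# Six-vertex model: operators of strip observables, the weighted trace formula and the
# composition rule (DKLM 2026, Part III §1, Lemma 55 (1)–(3) / Corollary 56 (1)–(3))

H. Duminil-Copin, K. K. Kozlowski, P. Lammers, I. Manolescu, *Gaussian free field convergence of
the six-vertex model with `-1 ≤ Δ ≤ -1/2`*, arXiv:2603.06268 (2026) [DKLM2026SixVertexGFF],
Part III §1 (`paper:arxiv-2603.06268`, chunks p0040–p0041):

> For each *valid triple* `(X, i, i')`, where `i ≤ i'` and `X` is an operator depending only on
> the edges in `E_{ii'}`, we define the operator `𝔬_X^{ii'} : Ω_i → Ω_{i'}` via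
> `e_{κ'}† 𝔬_X^{ii'} e_κ := Z^{ii'}_{κκ'} 𝔼^{ii'}_{κκ'}[X]`.
> **Corollary 56.** (1) *One-step partition function* […] (2) *Composition rule.* For any two
> valid triples `(X, i, i')` and `(Y, i', i'')`, […] `𝔬^{ii''}_{XY} = 𝔬^{i'i''}_Y ∘ 𝔬^{ii'}_X`.
> (3) *Torus measure.* `Z_{𝕋_{M,L}} ℙ_{𝕋_{M,L}}[{balanced}] 𝔼_{𝕋_{M,L}}[X | {balanced}] =
> Trace 𝔬^{0M}_X`.

This file generalises the strip operators of `SixVertexCylinderLimit.lean` (indicator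
observables) to **real-valued strip observables** `X` reading the incoming column state, the
`r' + 1` column states of the strip and its vertical arrows:

* `obsMatrix r' w X` — the operator `𝔬_X` (`stripMatrix` is the special case of an indicator,
  `stripMatrix_eq_obsMatrix`);
* `sum_obs_cyclic_eq_trace` — **Cor. 56 (3)**: on the torus with `r' + 1 + (s' + 1)` columns,
  `∑_{κ, α} X(strip) ∏_x w(κ_{x-1}, κ_x, α_x) = Trace (𝔬_X · t^{s'+1})`;
* `tensorObs X Y` and **`obsMatrix_tensorObs`** — **Cor. 56 (2), the composition rule**:
  `𝔬_{X ⊠ Y} = 𝔬_X · 𝔬_Y` for observables `X`, `Y` on adjacent strips (`X ⊠ Y` reads `X` on the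
  first `r₁' + 1` columns and `Y` on the following `r₂' + 1` columns, `Y`'s incoming state being
  the last column state of the first strip).

## References

* H. Duminil-Copin, K. K. Kozlowski, P. Lammers, I. Manolescu, arXiv:2603.06268 (2026),
  Part III §1, Lemma 55, Corollary 56. [DKLM2026SixVertexGFF]
-/

noncomputable section

open Finset Matrix

namespace Literature.Probability.LatticeModels.SixVertex

section Obs

variable {S V R : Type*} [Fintype S] [DecidableEq S] [Fintype V] [CommSemiring R]

/-- **The operator `𝔬_X` of a strip observable.** A strip observable on `r' + 1` consecutive
columns is a weight `X i κ α` depending on the incoming column state `i` (the east arrows of the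
column before the strip), the east column states `κ : Fin (r'+1) → S` of the strip and its
vertical arrows `α`; `𝔬_X(i, j) = ∑ X · ∏ w` over the strip configurations from `i` to `j`.
[cite: DKLM2026SixVertexGFF, Cor. 56] -/
def obsMatrix (r' : ℕ) (w : S → S → V → R) (X : S → (Fin (r' + 1) → S) → (Fin (r' + 1) → V) → R) :
    Matrix S S R :=
  Matrix.of fun i j => ∑ κ' : Fin r' → S, ∑ α' : Fin (r' + 1) → V,
    X i (Fin.snoc κ' j) α' *
      ∏ k : Fin (r' + 1),
        w ((Fin.cons i (Fin.snoc κ' j : Fin (r' + 1) → S) : Fin (r' + 2) → S) k.castSucc)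
          ((Fin.cons i (Fin.snoc κ' j : Fin (r' + 1) → S) : Fin (r' + 2) → S) k.succ) (α' k)

omit [DecidableEq S] in
/-- The strip operator of an event is the operator of its indicator. [cite: DKLM2026SixVertexGFF, Cor. 56] -/
theorem stripMatrix_eq_obsMatrix (r' : ℕ) (w : S → S → V → R)
    (D : (Fin (r' + 1) → S) → (Fin (r' + 1) → V) → Prop) [∀ κ α, Decidable (D κ α)] :
    stripMatrix r' w D = obsMatrix r' w (fun _ κ α => if D κ α then 1 else 0) := by
  ext i j
  simp only [stripMatrix, obsMatrix, Matrix.of_apply]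
  refine Finset.sum_congr rfl fun κ' _ => Finset.sum_congr rfl fun α' _ => ?_
  split_ifs <;> simp

/-- **Corollary 56 (3) for strip observables**: on the torus with `r' + 1 + (s' + 1)` columns,
the weighted sum `∑_{κ, α} X(strip) · ∏_x w(κ_{x-1}, κ_x, α_x)` — `X` reading the column before
the strip (index `r' + 1 + s'`) as incoming state and the first `r' + 1` columns — equals
`Trace (𝔬_X · t^{s'+1})`. [cite: DKLM2026SixVertexGFF, Cor. 56 (3)] -/
theorem sum_obs_cyclic_eq_trace (r' s' : ℕ) (w : S → S → V → R)
    (X : S → (Fin (r' + 1) → S) → (Fin (r' + 1) → V) → R) :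
    ∑ κ : Fin (r' + 1 + (s' + 1)) → S, ∑ α : Fin (r' + 1 + (s' + 1)) → V,
        X (κ (Fin.natAdd (r' + 1) (Fin.last s'))) (fun k => κ (Fin.castAdd (s' + 1) k))
            (fun k => α (Fin.castAdd (s' + 1) k)) *
          ∏ x : Fin (r' + 1 + (s' + 1)), w (κ (x - 1)) (κ x) (α x) =
      Matrix.trace (obsMatrix r' w X * colMatrix w ^ (s' + 1)) := by
  -- expand the right-hand side into a sixfold sum
  have hT : ∀ j i : S, (colMatrix w ^ (s' + 1)) j i = ∑ q : Fin s' → S, ∑ β : Fin (s' + 1) → V,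
      ∏ k : Fin (s' + 1),
        w ((Fin.cons j (Fin.snoc q i : Fin (s' + 1) → S) : Fin (s' + 2) → S) k.castSucc)
          ((Fin.cons j (Fin.snoc q i : Fin (s' + 1) → S) : Fin (s' + 2) → S) k.succ) (β k) := by
    intro j i
    rw [pow_succ_apply_eq_sum_paths]
    refine Finset.sum_congr rfl fun q _ => ?_
    simp only [colMatrix, Matrix.of_apply]
    rw [Finset.prod_univ_sum, Fintype.piFinset_univ]
  rw [Matrix.trace]
  simp only [Matrix.diag_apply, Matrix.mul_apply, hT, obsMatrix, Matrix.of_apply,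
    Finset.sum_mul_sum]
  -- reparametrise the left-hand side: `κ = append (snoc κ' j) (snoc q i)`, `α = append α₁ α₂`
  rw [← (Fin.appendEquiv (r' + 1) (s' + 1)).sum_comp, Fintype.sum_prod_type]
  simp only [Fin.appendEquiv_apply]
  have hα : ∀ κ₁ : Fin (r' + 1) → S, ∀ κ₂ : Fin (s' + 1) → S,
      (∑ α : Fin (r' + 1 + (s' + 1)) → V,
        X (Fin.append κ₁ κ₂ (Fin.natAdd (r' + 1) (Fin.last s')))
            (fun k => Fin.append κ₁ κ₂ (Fin.castAdd (s' + 1) k))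
            (fun k => α (Fin.castAdd (s' + 1) k)) *
          ∏ x, w (Fin.append κ₁ κ₂ (x - 1)) (Fin.append κ₁ κ₂ x) (α x)) =
      ∑ α₁ : Fin (r' + 1) → V, ∑ α₂ : Fin (s' + 1) → V,
        X (κ₂ (Fin.last s')) κ₁ α₁ *
          ∏ x, w (Fin.append κ₁ κ₂ (x - 1)) (Fin.append κ₁ κ₂ x) (Fin.append α₁ α₂ x) := by
    intro κ₁ κ₂
    rw [← (Fin.appendEquiv (r' + 1) (s' + 1)).sum_comp, Fintype.sum_prod_type]
    simp only [Fin.appendEquiv_apply, Fin.append_left, Fin.append_right]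
  simp only [hα]
  rw [← (Fin.snocEquiv fun _ => S).sum_comp, Fintype.sum_prod_type]
  simp only [show ∀ (a : S) (b : Fin r' → S),
    ((Fin.snocEquiv fun _ => S) (a, b) : Fin (r' + 1) → S) = Fin.snoc b a from fun _ _ => rfl]
  have hκ₂ : ∀ F : (Fin (s' + 1) → S) → R,
      ∑ κ₂ : Fin (s' + 1) → S, F κ₂ = ∑ i : S, ∑ q : Fin s' → S, F (Fin.snoc q i) := by
    intro F
    rw [← (Fin.snocEquiv fun _ => S).sum_comp, Fintype.sum_prod_type]
    rfl
  simp only [hκ₂, Fin.snoc_last]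
  -- both sides are now sums over `j, κ', i, q, α₁, α₂` resp. `i, j, κ', q, α', β`; reorder
  conv_lhs =>
    arg 2
    ext j
    rw [Finset.sum_comm]
  conv_lhs => rw [Finset.sum_comm]
  refine Finset.sum_congr rfl fun i _ => Finset.sum_congr rfl fun j _ =>
    Finset.sum_congr rfl fun κ' _ => Finset.sum_congr rfl fun q _ =>
    Finset.sum_congr rfl fun α₁ _ => Finset.sum_congr rfl fun α₂ _ => ?_
  -- termwise
  rw [prod_cyclic_append, mul_assoc]

/-! ### Evaluating glued tuples by the value of the index -/

omit [Fintype S] [DecidableEq S] in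
/-- `cons i K' x = i` when `x` has value `0`. [folklore] -/
theorem cons_apply_of_val_eq_zero {n : ℕ} (i : S) (K' : Fin (n + 1) → S) (x : Fin (n + 2))
    (hx : x.val = 0) : (Fin.cons i K' : Fin (n + 2) → S) x = i := by
  have : x = 0 := Fin.ext hx
  subst this
  rfl

omit [Fintype S] [DecidableEq S] in
/-- `cons i (snoc K j) x = K t` when `x` has value `t + 1`, `t < N`. [folklore] -/
theorem cons_snoc_apply_of_val_eq_succ {N : ℕ} (i j : S) (K : Fin N → S) (x : Fin (N + 2))
    (t : ℕ) (ht : t < N) (hx : x.val = t + 1) :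
    (Fin.cons i (Fin.snoc K j : Fin (N + 1) → S) : Fin (N + 2) → S) x = K ⟨t, ht⟩ := by
  have h1 : x = (Fin.castSucc (⟨t, ht⟩ : Fin N)).succ := Fin.ext (by simp [hx])
  rw [h1, Fin.cons_succ, Fin.snoc_castSucc]

omit [Fintype S] [DecidableEq S] in
/-- `cons i (snoc K j) x = j` when `x` has value `N + 1`. [folklore] -/
theorem cons_snoc_apply_of_val_eq_last {N : ℕ} (i j : S) (K : Fin N → S) (x : Fin (N + 2))
    (hx : x.val = N + 1) :
    (Fin.cons i (Fin.snoc K j : Fin (N + 1) → S) : Fin (N + 2) → S) x = j := by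
  have h1 : x = (Fin.last N).succ := Fin.ext (by simp [hx])
  rw [h1, Fin.cons_succ, Fin.snoc_last]

omit [Fintype S] [DecidableEq S] in
/-- `snoc P j y = P y` when `y.val < N`. [folklore] -/
theorem snoc_apply_of_val_lt {N : ℕ} (P : Fin N → S) (j : S) (y : Fin (N + 1)) (hy : y.val < N) :
    (Fin.snoc P j : Fin (N + 1) → S) y = P ⟨y.val, hy⟩ := by
  have h1 : y = Fin.castSucc (⟨y.val, hy⟩ : Fin N) := Fin.ext (by simp)
  conv_lhs => rw [h1]
  rw [Fin.snoc_castSucc]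

omit [Fintype S] [DecidableEq S] in
/-- `snoc P j y = j` when `y.val = N`. [folklore] -/
theorem snoc_apply_of_val_eq {N : ℕ} (P : Fin N → S) (j : S) (y : Fin (N + 1)) (hy : y.val = N) :
    (Fin.snoc P j : Fin (N + 1) → S) y = j := by
  have h1 : y = Fin.last N := Fin.ext (by simp [hy])
  rw [h1, Fin.snoc_last]

omit [Fintype S] [DecidableEq S] in
/-- The glued strip states `append (snoc κ₁ s) κ₂` on the first block. [folklore] -/
theorem append_snoc_apply_of_val_lt {r₁' r₂' : ℕ} (κ₁ : Fin r₁' → S) (s : S) (κ₂ : Fin r₂' → S)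
    (y : Fin (r₁' + 1 + r₂')) (hy : y.val < r₁') :
    Fin.append (Fin.snoc κ₁ s : Fin (r₁' + 1) → S) κ₂ y = κ₁ ⟨y.val, hy⟩ := by
  have h1 : y = Fin.castAdd r₂' (Fin.castSucc (⟨y.val, hy⟩ : Fin r₁')) := Fin.ext (by simp)
  conv_lhs => rw [h1]
  rw [Fin.append_left, Fin.snoc_castSucc]

omit [Fintype S] [DecidableEq S] in
/-- The glued strip states at the junction. [folklore] -/
theorem append_snoc_apply_of_val_eq {r₁' r₂' : ℕ} (κ₁ : Fin r₁' → S) (s : S) (κ₂ : Fin r₂' → S)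
    (y : Fin (r₁' + 1 + r₂')) (hy : y.val = r₁') :
    Fin.append (Fin.snoc κ₁ s : Fin (r₁' + 1) → S) κ₂ y = s := by
  have h1 : y = Fin.castAdd r₂' (Fin.last r₁') := Fin.ext (by simp [hy])
  rw [h1, Fin.append_left, Fin.snoc_last]

omit [Fintype S] [DecidableEq S] in
/-- The glued strip states on the second block. [folklore] -/
theorem append_snoc_apply_of_val_eq_add {r₁' r₂' : ℕ} (κ₁ : Fin r₁' → S) (s : S) (κ₂ : Fin r₂' → S)
    (y : Fin (r₁' + 1 + r₂')) (t : ℕ) (ht : t < r₂') (hy : y.val = r₁' + 1 + t) :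
    Fin.append (Fin.snoc κ₁ s : Fin (r₁' + 1) → S) κ₂ y = κ₂ ⟨t, ht⟩ := by
  have h1 : y = Fin.natAdd (r₁' + 1) (⟨t, ht⟩ : Fin r₂') := Fin.ext (by simp [hy])
  rw [h1, Fin.append_right]

/-! ### The composition rule (Cor. 56 (2)) -/

/-- **Concatenation of strip observables**: `X ⊠ Y` reads `X` on the first `r₁' + 1` columns and
`Y` on the following `r₂' + 1` columns; the incoming state of `Y`'s strip is the last column
state of `X`'s strip. [cite: DKLM2026SixVertexGFF, Cor. 56 (2)] -/
def tensorObs {r₁' r₂' : ℕ} (X : S → (Fin (r₁' + 1) → S) → (Fin (r₁' + 1) → V) → R)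
    (Y : S → (Fin (r₂' + 1) → S) → (Fin (r₂' + 1) → V) → R) :
    S → (Fin (r₁' + 1 + r₂' + 1) → S) → (Fin (r₁' + 1 + r₂' + 1) → V) → R :=
  fun i κ α =>
    X i (fun k => κ (Fin.castAdd (r₂' + 1) k)) (fun k => α (Fin.castAdd (r₂' + 1) k)) *
      Y (κ (Fin.castAdd (r₂' + 1) (Fin.last r₁'))) (fun k => κ (Fin.natAdd (r₁' + 1) k))
        (fun k => α (Fin.natAdd (r₁' + 1) k))

omit [DecidableEq S] in
/-- **Corollary 56 (2), the composition rule**: `𝔬_{X ⊠ Y} = 𝔬_X · 𝔬_Y` (as matrices indexed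
`(incoming, outgoing)`; the paper composes operators `Ω_i → Ω_{i'} → Ω_{i''}`).
[cite: DKLM2026SixVertexGFF, Cor. 56 (2)] -/
theorem obsMatrix_tensorObs {r₁' r₂' : ℕ} (w : S → S → V → R)
    (X : S → (Fin (r₁' + 1) → S) → (Fin (r₁' + 1) → V) → R)
    (Y : S → (Fin (r₂' + 1) → S) → (Fin (r₂' + 1) → V) → R) :
    obsMatrix (r₁' + 1 + r₂') w (tensorObs X Y) = obsMatrix r₁' w X * obsMatrix r₂' w Y := by
  ext i j
  simp only [obsMatrix, Matrix.mul_apply, Matrix.of_apply, Finset.sum_mul_sum]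
  -- right-hand side is now `∑ s, ∑ κ₁, ∑ κ₂, ∑ α₁, ∑ α₂`
  -- left-hand side: decompose `κ = append (snoc κ₁ s) κ₂`, `α = append α₁ α₂`
  rw [← (Fin.appendEquiv (r₁' + 1) r₂').sum_comp, Fintype.sum_prod_type]
  simp only [show ∀ fg : (Fin (r₁' + 1) → S) × (Fin r₂' → S),
    ((Fin.appendEquiv (r₁' + 1) r₂') fg : Fin (r₁' + 1 + r₂') → S) = Fin.append fg.1 fg.2 from
    fun _ => rfl]
  rw [← (Fin.snocEquiv fun _ => S).sum_comp, Fintype.sum_prod_type]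
  simp only [show ∀ (a : S) (b : Fin r₁' → S),
    ((Fin.snocEquiv fun _ => S) (a, b) : Fin (r₁' + 1) → S) = Fin.snoc b a from fun _ _ => rfl]
  refine Finset.sum_congr rfl fun s _ => Finset.sum_congr rfl fun κ₁ _ =>
    Finset.sum_congr rfl fun κ₂ _ => ?_
  erw [← (Fin.appendEquiv (r₁' + 1) (r₂' + 1)).sum_comp]
  rw [Fintype.sum_prod_type]
  simp only [Fin.appendEquiv_apply]
  refine Finset.sum_congr rfl fun α₁ _ => Finset.sum_congr rfl fun α₂ _ => ?_
  -- the glued strip `K = snoc (append (snoc κ₁ s) κ₂) j` read blockwise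
  set K : Fin (r₁' + 1 + r₂' + 1) → S :=
    Fin.snoc (Fin.append (Fin.snoc κ₁ s : Fin (r₁' + 1) → S) κ₂) j with hK
  have hK1 : ∀ k : Fin (r₁' + 1),
      K (Fin.castAdd (r₂' + 1) k) = (Fin.snoc κ₁ s : Fin (r₁' + 1) → S) k := by
    intro k
    induction k using Fin.lastCases with
    | last =>
      rw [Fin.snoc_last, hK, snoc_apply_of_val_lt _ _ _ (by simp; omega)]
      exact append_snoc_apply_of_val_eq _ _ _ _ (by simp)
    | cast k =>
      have hk := k.2
      rw [Fin.snoc_castSucc, hK, snoc_apply_of_val_lt _ _ _ (by simp; omega),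
        append_snoc_apply_of_val_lt _ _ _ _ (by simp)]
      all_goals exact congrArg κ₁ (Fin.ext (by simp))
  have hK2 : ∀ k : Fin (r₂' + 1),
      K (Fin.natAdd (r₁' + 1) k) = (Fin.snoc κ₂ j : Fin (r₂' + 1) → S) k := by
    intro k
    induction k using Fin.lastCases with
    | last =>
      rw [Fin.snoc_last, hK]
      exact snoc_apply_of_val_eq _ _ _ (by simp)
    | cast k =>
      have hk := k.2
      rw [Fin.snoc_castSucc, hK, snoc_apply_of_val_lt _ _ _ (by simp)]
      exact append_snoc_apply_of_val_eq_add _ _ _ _ k.val hk (by simp)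
  -- the observable factorises
  have hobs : tensorObs X Y i K (Fin.append α₁ α₂ : Fin (r₁' + 1 + (r₂' + 1)) → V) =
      X i (Fin.snoc κ₁ s) α₁ * Y s (Fin.snoc κ₂ j) α₂ := by
    simp only [tensorObs, hK1, hK2, Fin.append_left, Fin.append_right, Fin.snoc_last]
  -- the product factorises
  have hprod : (∏ k : Fin (r₁' + 1 + (r₂' + 1)),
      w ((Fin.cons i K : Fin (r₁' + 1 + r₂' + 2) → S) k.castSucc)
        ((Fin.cons i K : Fin (r₁' + 1 + r₂' + 2) → S) k.succ)
        ((Fin.append α₁ α₂ : Fin (r₁' + 1 + (r₂' + 1)) → V) k)) =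
      (∏ k : Fin (r₁' + 1),
        w ((Fin.cons i (Fin.snoc κ₁ s : Fin (r₁' + 1) → S) : Fin (r₁' + 2) → S) k.castSucc)
          ((Fin.cons i (Fin.snoc κ₁ s : Fin (r₁' + 1) → S) : Fin (r₁' + 2) → S) k.succ) (α₁ k)) *
      ∏ k : Fin (r₂' + 1),
        w ((Fin.cons s (Fin.snoc κ₂ j : Fin (r₂' + 1) → S) : Fin (r₂' + 2) → S) k.castSucc)
          ((Fin.cons s (Fin.snoc κ₂ j : Fin (r₂' + 1) → S) : Fin (r₂' + 2) → S) k.succ) (α₂ k) := by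
    rw [Fin.prod_univ_add]
    congr 1
    · refine Finset.prod_congr rfl fun k _ => ?_
      rw [Fin.append_left]
      congr 1
      · -- `u (castSucc (castAdd k)) = u₁ (castSucc k)`
        induction k using Fin.cases with
        | zero =>
          rw [cons_apply_of_val_eq_zero _ _ _ (by simp), Fin.castSucc_zero, Fin.cons_zero]
        | succ k =>
          rw [show (Fin.castAdd (r₂' + 1) k.succ).castSucc = (Fin.castAdd (r₂' + 1) k.castSucc).succ
              from Fin.ext (by simp), Fin.cons_succ, hK1, Fin.castSucc_succ, Fin.cons_succ]
      · -- `u (succ (castAdd k)) = u₁ (succ k)`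
        rw [Fin.cons_succ, Fin.cons_succ, hK1]
    · refine Finset.prod_congr rfl fun k _ => ?_
      rw [Fin.append_right]
      congr 1
      · -- `u (castSucc (natAdd k)) = u₂ (castSucc k)`
        induction k using Fin.cases with
        | zero =>
          rw [show (Fin.natAdd (r₁' + 1) (0 : Fin (r₂' + 1))).castSucc =
              (Fin.castAdd (r₂' + 1) (Fin.last r₁')).succ from Fin.ext (by simp),
            Fin.cons_succ, hK1, Fin.snoc_last, Fin.castSucc_zero, Fin.cons_zero]
        | succ k =>
          rw [show (Fin.natAdd (r₁' + 1) k.succ).castSucc = (Fin.natAdd (r₁' + 1) k.castSucc).succ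
              from Fin.ext (by simp; omega), Fin.cons_succ, hK2, Fin.castSucc_succ, Fin.cons_succ]
      · -- `u (succ (natAdd k)) = u₂ (succ k)`
        rw [Fin.cons_succ, Fin.cons_succ, hK2]
  -- assemble
  show tensorObs X Y i K (Fin.append α₁ α₂ : Fin (r₁' + 1 + (r₂' + 1)) → V) *
      (∏ k : Fin (r₁' + 1 + (r₂' + 1)),
        w ((Fin.cons i K : Fin (r₁' + 1 + r₂' + 2) → S) k.castSucc)
          ((Fin.cons i K : Fin (r₁' + 1 + r₂' + 2) → S) k.succ)
          ((Fin.append α₁ α₂ : Fin (r₁' + 1 + (r₂' + 1)) → V) k)) = _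
  rw [hobs, hprod]
  ring

end Obs

end Literature.Probability.LatticeModels.SixVertex

end
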